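import Mathlib
import HarnessLib
import Summits.AtomisticToContinuum.FouriersLaw.Theses.LatticeLandauDamping
import Literature.MathematicalPhysics.KineticTheory.ZeroWavenumberSpace

/-!
# Birth skeleton (BC3) for the crux `NoDrudeWeight` — line `birth` ("Mazur transfer to `ℋ₀`")

Crux (FIXED, concluded below BY NAME): `Summit.AtomisticToContinuum.FouriersLaw.Theses.LatticeLandauDamping.NoDrudeWeight`
(stmt-AtomisticToContinuum-14012, route `LatticeLandauDamping`, sub-problem `FouriersLaw`, rank 4):
for `pinnedChain ω₂ lam β γ` (all `> 0`), every `T > 0`, every shift-invariant DLR Gibbs state `μ_T`, every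
`μ_T`-preserving infinite-volume dynamics `D` with absolutely convergent summed current correlations and every
finite measure `σ` with `C_T(t) = D.currentCorrelation μ_T t = ∫ cos(ωt) dσ(ω)` for all `t`: `σ{0} = 0`
(no Drude weight = no atom of the current spectral measure at frequency `0`).

## The line (the route's own TWO-LAYER PLAN "NoFiniteTrap → NoL2OddCharge → NoDrudeWeight", typed)

Transfer the atom into Doyon's zero-wavenumber Hilbert space `ℋ₀(μ_T)` (landed vocabulary
`Literature/MathematicalPhysics/KineticTheory/ZeroWavenumberSpace.lean`), where it becomes the squared
hydrodynamic projection of the current class, and kill that projection by momentum-reversal PARITY: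

* `stub_zeroWavenumberFramework` (FRAMEWORK, L): every admissible pair `(μ_T, D)` of the crux carries a
  `ZeroWavenumberData Z` with state `Z.μ = μ_T` and momentum-reversal symmetry `Z.HasMomentumReversal`
  (the LadderFramework half of the route; content: `R`-invariance of the UNIQUE shift-invariant DLR state
  `eq_of_isChainGibbsMeasure_of_isShiftInvariant_pinnedChain`, a.e. shift/reversal covariance of any
  `μ_T`-preserving flow, space–time `ℓ¹` clustering of the current/energy two-point functions —
  `InfiniteChainClusteringTransfer`, `InfiniteChainL2Locality`, `InfiniteChainCurrentPositiveType`).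
* `stub_atomEqDrudeWeight` (FUNCTIONAL ANALYSIS, M–L, provable now): if `⟪ψ, U_t ψ⟫₀ = ∫ cos(ωt) dσ(ω)` for
  all `t` (finite `σ`), then `σ{0} = 𝖣_ψ = ‖ℙ ψ‖²`, `ℙ` the hydrodynamic projection onto the conserved space
  `𝒬₀` (Wiener's lemma for the atom at `0` + von Neumann's mean ergodic theorem in continuous time, PROVED in
  tree as `Literature.Barriers.AtomisticToContinuum.Mazur.tendsto_inv_mul_integral_inner` = Suzuki's equality,
  applied on the cyclic subspace of `ψ`, where `t ↦ U_t ψ` is strongly continuous because `t ↦ ⟪ψ, U_t ψ⟫₀` is).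
* `stub_conservedClassesEven` (THE PHYSICS — "no hidden odd charge", open-problem class, HARDEST): for the
  pinned anharmonic chain in a Gibbs state at `T > 0`, momentum reversal `Θ` acts TRIVIALLY on the conserved
  space `𝒬₀ ⊆ ℋ₀`: every flow-invariant zero-wavenumber class is even (no momentum-like ballistic mode; the
  only expected conserved class is the even energy class `[h]`).
* `NoDrudeWeight_of` (kernel-checked composition, no sorry): `Θ` is an isometric involution with
  `Θ[J] = −[J]` (`reversal_currentClass`), so for every `u ∈ 𝒬₀`, `⟪u, [J]⟫₀ = ⟪Θu, Θ[J]⟫₀ = −⟪u, [J]⟫₀ = 0`,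
  i.e. `[J] ⊥ 𝒬₀`, `𝖣_J = 0` (`FluctuationDynamics.drudeWeight_eq_zero_iff`); with
  `⟪[J], U_t[J]⟫₀ = C_T(t)` (`inner_currentClass_koopman_eq_currentCorrelation'`) the atom lemma gives
  `(σ{0}).toReal = 𝖣_J = 0`, and `σ` finite gives `σ{0} = 0`.

Honours the crux's "why it might fail" exactly: the line fails iff `stub_conservedClassesEven` fails, i.e. iff
a flow-invariant `ℋ₀`-class odd under momentum reversal exists (a hidden odd quasi-local conservation law ⇒
Mazur atom). Barriers: `Literature.Barriers.AtomisticToContinuum.Mazur1969_inequality` /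
`MazurBoundBallisticNarrow` are USED (Suzuki's equality is the content of `stub_atomEqDrudeWeight`), not
evaded; `HarmonicChainBallisticFlux`: at `lam = β = 0` `stub_conservedClassesEven` is false (odd conserved
normal-mode currents) — the stub is claimed only for `lam, β > 0`, the crux's quantifiers.
Disproof.lean for this crux: none on file (2026-08-17). Dead lines: none.

## File map

* §1 `Sig.stub_<name> : Prop` — the three stub STATEMENTS.
* §2 `theorem stub_<name> : <statement verbatim> := by sorry` — the registered stubs (the ONLY sorries).
* §3 `NoDrudeWeight_of : Sig.stub_zeroWavenumberFramework → Sig.stub_atomEqDrudeWeight →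
  Sig.stub_conservedClassesEven → NoDrudeWeight` — the composition (no sorry; the UNIQUE declaration
  concluding the crux), and an `example` instantiating it through the sorried stubs.
-/

namespace Summit.AtomisticToContinuum.FouriersLaw.Cruxes.NoDrudeWeight.Birth

open scoped InnerProductSpace ENNReal

/-! ## §1 The stub statements -/

/-- FRAMEWORK: every admissible `(μ_T, D)` of the crux carries Doyon's zero-wavenumber structure with state
`μ_T` and momentum-reversal symmetry. -/
def Sig.stub_zeroWavenumberFramework : Prop :=
  ∀ ω₂ lam β γ : ℝ, 0 < ω₂ → 0 < lam → 0 < β → 0 < γ → ∀ T : ℝ, 0 < T →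
    ∀ (μT : MeasureTheory.Measure Literature.MathematicalPhysics.KineticTheory.HeatConduction.ChainConfig)
      (D : Literature.MathematicalPhysics.KineticTheory.HeatConduction.InfiniteChainDynamics
        (Literature.MathematicalPhysics.KineticTheory.HeatConduction.pinnedChain ω₂ lam β γ)),
      (Literature.MathematicalPhysics.KineticTheory.HeatConduction.pinnedChain ω₂ lam β γ).IsChainGibbsMeasure T μT →
      (∀ x : ℤ, MeasureTheory.MeasurePreserving
        (fun σ : Literature.MathematicalPhysics.KineticTheory.HeatConduction.ChainConfig => fun i : ℤ => σ (i + x)) μT μT) →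
      D.PreservesMeasure μT → (∀ t : ℝ, D.HasAbsConvergentCorrelation μT t) →
      ∃ Z : Literature.MathematicalPhysics.KineticTheory.HeatConduction.ZeroWavenumberData
          (Literature.MathematicalPhysics.KineticTheory.HeatConduction.pinnedChain ω₂ lam β γ) D,
        Z.μ = μT ∧ Z.HasMomentumReversal

/-- FUNCTIONAL ANALYSIS (Wiener + von Neumann/Suzuki): the atom at `0` of a spectral measure of `ψ` under the
Koopman group of `ℋ₀` is the Drude weight `‖ℙ ψ‖²`. -/
def Sig.stub_atomEqDrudeWeight : Prop :=
  ∀ (P : Literature.MathematicalPhysics.KineticTheory.HeatConduction.OscillatorChain)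
    (D : Literature.MathematicalPhysics.KineticTheory.HeatConduction.InfiniteChainDynamics P)
    (Z : Literature.MathematicalPhysics.KineticTheory.HeatConduction.ZeroWavenumberData P D)
    (ψ : Literature.MathematicalPhysics.KineticTheory.HeatConduction.ZeroWavenumberSpace Z)
    (σ : MeasureTheory.Measure ℝ), MeasureTheory.IsFiniteMeasure σ →
    (∀ t : ℝ, ⟪ψ, Z.koopman t ψ⟫_ℝ = MeasureTheory.integral σ (fun ω : ℝ => Real.cos (ω * t))) →
    (σ {0}).toReal = Z.toFluctuationDynamics.drudeWeight ψ

/-- THE PHYSICS (no hidden odd charge): momentum reversal acts trivially on the conserved space `𝒬₀ ⊆ ℋ₀`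
of the pinned anharmonic chain in a Gibbs state. -/
def Sig.stub_conservedClassesEven : Prop :=
  ∀ ω₂ lam β γ : ℝ, 0 < ω₂ → 0 < lam → 0 < β → 0 < γ → ∀ T : ℝ, 0 < T →
    ∀ (D : Literature.MathematicalPhysics.KineticTheory.HeatConduction.InfiniteChainDynamics
        (Literature.MathematicalPhysics.KineticTheory.HeatConduction.pinnedChain ω₂ lam β γ))
      (Z : Literature.MathematicalPhysics.KineticTheory.HeatConduction.ZeroWavenumberData
        (Literature.MathematicalPhysics.KineticTheory.HeatConduction.pinnedChain ω₂ lam β γ) D),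
      (Literature.MathematicalPhysics.KineticTheory.HeatConduction.pinnedChain ω₂ lam β γ).IsChainGibbsMeasure T Z.μ →
      ∀ (h : Z.HasMomentumReversal)
        (ψ : Literature.MathematicalPhysics.KineticTheory.HeatConduction.ZeroWavenumberSpace Z),
        ψ ∈ Z.toFluctuationDynamics.conservedSpace → Z.reversal h ψ = ψ

/-! ## §2 The registered stubs (the only sorries of this file) -/

/-- **STUB 1 — `stub_zeroWavenumberFramework`** (framework; size L). For `pinnedChain ω₂ lam β γ`
(all `> 0`), `T > 0`, every shift-invariant DLR Gibbs state `μ_T` and every `μ_T`-preserving infinite-volume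
dynamics `D` with absolutely convergent summed current correlations there is a `ZeroWavenumberData Z` for
`(pinnedChain, D)` with `Z.μ = μ_T` and `Z.HasMomentumReversal`.
Why plausibly true: `μ_T` is THE shift-invariant DLR state (`eq_of_isChainGibbsMeasure_of_isShiftInvariant_pinnedChain`),
hence momentum-reversal invariant and superstable (`hasSuperstabilityEstimate_of_isShiftInvariant_pinnedChain`,
`map_momentumReversalZ_eq_of_regular_unique`); take `localObs :=` the span of the flow/shift/reversal orbit of
`{j_0, h_0}`; the current–current clustering IS the crux hypothesis `HasAbsConvergentCorrelation` (mean current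
`0`), the energy terms come from `InfiniteChainClusteringTransfer` (spatial mixing of the 1-D transfer-operator
state + fixed-time `L²`-locality `InfiniteChainL2Locality`); `form_self_nonneg` is automatic from absolute
summability (Fejér); a.e. shift/reversal covariance of an ARBITRARY `μ_T`-preserving `D` needs a.e. agreement with
the Buttà–Marchioro flow on `bmGood` (`flow_comp_chainShift_ae_of_carrier_subset_bmGood`,
`chainReversal_comp_flow_ae_of_carrier_eq_bmGood`, LLL Thm 2 uniqueness `InfiniteChainUniquenessProofs`).
Why it might fail: a `μ_T`-preserving dynamics whose carrier is not (a.e.) reversal/shift symmetric and whose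
orbits leave the LLL growth class — then `flow_comm_shift` / `reversal_flow` are not available; dynamic
clustering of energy–energy correlations at fixed `t ≠ 0` for quartic `V` is only known through the
almost-linear light cone (`ButtaMarchioro2016_thm22_chain`, a named fact).
Leans on: `ZeroWavenumberData`, `HasMomentumReversal`, `InfiniteChainShiftInvariantUniqueness`,
`InfiniteChainSuperstableReversal`, `InfiniteChainGoodSetSymmetries`, `InfiniteChainClusteringTransfer`,
`InfiniteChainCurrentPositiveType`. -/
theorem stub_zeroWavenumberFramework :
    ∀ ω₂ lam β γ : ℝ, 0 < ω₂ → 0 < lam → 0 < β → 0 < γ → ∀ T : ℝ, 0 < T →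
    ∀ (μT : MeasureTheory.Measure Literature.MathematicalPhysics.KineticTheory.HeatConduction.ChainConfig)
      (D : Literature.MathematicalPhysics.KineticTheory.HeatConduction.InfiniteChainDynamics
        (Literature.MathematicalPhysics.KineticTheory.HeatConduction.pinnedChain ω₂ lam β γ)),
      (Literature.MathematicalPhysics.KineticTheory.HeatConduction.pinnedChain ω₂ lam β γ).IsChainGibbsMeasure T μT →
      (∀ x : ℤ, MeasureTheory.MeasurePreserving
        (fun σ : Literature.MathematicalPhysics.KineticTheory.HeatConduction.ChainConfig => fun i : ℤ => σ (i + x)) μT μT) →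
      D.PreservesMeasure μT → (∀ t : ℝ, D.HasAbsConvergentCorrelation μT t) →
      ∃ Z : Literature.MathematicalPhysics.KineticTheory.HeatConduction.ZeroWavenumberData
          (Literature.MathematicalPhysics.KineticTheory.HeatConduction.pinnedChain ω₂ lam β γ) D,
        Z.μ = μT ∧ Z.HasMomentumReversal := by
  sorry

/-- **STUB 2 — `stub_atomEqDrudeWeight`** (pure functional analysis; size M–L; provable now). For ANY chain
`P`, dynamics `D`, zero-wavenumber datum `Z`, class `ψ ∈ ℋ₀` and finite measure `σ` on `ℝ` with
`⟪ψ, U_t ψ⟫₀ = ∫ cos(ωt) dσ(ω)` for all `t`: `σ{0} = 𝖣_ψ = ‖ℙ_{𝒬₀} ψ‖²`.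
Proof sketch: (a) Wiener — `τ⁻¹∫₀^τ ∫cos(ωt)dσ dt = ∫ sinc(ωτ) dσ → σ{0}` (Fubini + dominated convergence);
(b) `t ↦ U_t ψ` is norm-continuous since `‖U_t ψ − U_s ψ‖² = 2⟪ψ,ψ⟫₀ − 2⟪ψ, U_{t−s} ψ⟫₀` and the right side is
continuous, so on the closed cyclic subspace `E_ψ` of `ψ` the Koopman group is a strongly continuous unitary
group and `Mazur.tendsto_inv_mul_integral_inner` gives `τ⁻¹∫₀^τ ⟪U_t ψ, ψ⟫₀ → ‖P_{𝒬₀ ∩ E_ψ} ψ‖²`;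
(c) `P_{𝒬₀ ∩ E_ψ} ψ = ℙ ψ` (`E_ψ` and `E_ψ^⊥` are `U`-invariant, so the `E_ψ`-component of a conserved
vector is conserved); uniqueness of limits.
Why it might fail: it does not (theorem-grade); the only trap is forgetting that strong continuity is NOT a
field of the datum — it must be derived on the cyclic subspace from the cosine representation.
Leans on: `Literature.Barriers.AtomisticToContinuum.Mazur.tendsto_inv_mul_integral_inner`,
`Mazur.IsContractionSemigroup`, `FluctuationDynamics.drudeWeight_eq_inner`, `hydroProjection`,
`koopman_add_apply`, `inner_koopman_koopman`, Mathlib `Submodule.starProjection`, `intervalIntegral`. -/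
theorem stub_atomEqDrudeWeight :
    ∀ (P : Literature.MathematicalPhysics.KineticTheory.HeatConduction.OscillatorChain)
    (D : Literature.MathematicalPhysics.KineticTheory.HeatConduction.InfiniteChainDynamics P)
    (Z : Literature.MathematicalPhysics.KineticTheory.HeatConduction.ZeroWavenumberData P D)
    (ψ : Literature.MathematicalPhysics.KineticTheory.HeatConduction.ZeroWavenumberSpace Z)
    (σ : MeasureTheory.Measure ℝ), MeasureTheory.IsFiniteMeasure σ →
    (∀ t : ℝ, ⟪ψ, Z.koopman t ψ⟫_ℝ = MeasureTheory.integral σ (fun ω : ℝ => Real.cos (ω * t))) →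
    (σ {0}).toReal = Z.toFluctuationDynamics.drudeWeight ψ := by
  sorry

/-- **STUB 3 — `stub_conservedClassesEven`** (THE PHYSICS, "NoL2OddCharge"; open-problem class; HARDEST).
For `pinnedChain ω₂ lam β γ` (all `> 0`), `T > 0`, every dynamics `D` and every zero-wavenumber datum `Z` whose
state is a DLR Gibbs state at `T` and which has momentum-reversal symmetry `Θ`: `Θ ψ = ψ` for every `ψ` in the
conserved space `𝒬₀ = {ψ | U_t ψ = ψ ∀ t}` — time reversal acts trivially on the hydrodynamic sector
(equivalently, since `Θ 𝒬₀ = 𝒬₀`: no non-zero ODD conserved class; expected because the only conserved class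
should be the even energy class `[h]`).
Why plausibly true: pinning destroys momentum conservation (`LoweredCurrent`: `R†J ≢ 0`), the local charge
census finds no conservation law besides energy for `lam, β > 0` (NoHiddenCharges' certified data, ranges ≤ 5),
and in the ladder picture an odd kernel vector of `R − R†` would have to survive the gapped Smoluchowski floor
(`FloorGap`) degree by degree.
Why it might fail: a pseudo-local (ℋ₀-limit, not local) odd invariant class — breather / KAM-like dust at
strong pinning or low `T` — is not excluded by any local census; false at the harmonic point `lam = β = 0`
(odd conserved normal-mode currents), so any proof must use `lam, β > 0`.
Leans on: `ZeroWavenumberData.reversal`, `reversal_koopman` (`Θ U_t = U_{-t} Θ`, so `Θ 𝒬₀ = 𝒬₀`),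
`FluctuationDynamics.conservedSpace`, `generator_eq_zero_of_mem_conservedSpace`, `MomentumHermiteLadder`
(`liouvillian_eq_momentumRaising_sub_momentumLowering`), route supports `FloorGap`, `LoweredCurrent`. -/
theorem stub_conservedClassesEven :
    ∀ ω₂ lam β γ : ℝ, 0 < ω₂ → 0 < lam → 0 < β → 0 < γ → ∀ T : ℝ, 0 < T →
    ∀ (D : Literature.MathematicalPhysics.KineticTheory.HeatConduction.InfiniteChainDynamics
        (Literature.MathematicalPhysics.KineticTheory.HeatConduction.pinnedChain ω₂ lam β γ))
      (Z : Literature.MathematicalPhysics.KineticTheory.HeatConduction.ZeroWavenumberData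
        (Literature.MathematicalPhysics.KineticTheory.HeatConduction.pinnedChain ω₂ lam β γ) D),
      (Literature.MathematicalPhysics.KineticTheory.HeatConduction.pinnedChain ω₂ lam β γ).IsChainGibbsMeasure T Z.μ →
      ∀ (h : Z.HasMomentumReversal)
        (ψ : Literature.MathematicalPhysics.KineticTheory.HeatConduction.ZeroWavenumberSpace Z),
        ψ ∈ Z.toFluctuationDynamics.conservedSpace → Z.reversal h ψ = ψ := by
  sorry

/-! ## §3 The composition (kernel-checked, no sorry) -/

open Literature.MathematicalPhysics.KineticTheory in
/-- **THE SKELETON THEOREM.** `Sig.stub_zeroWavenumberFramework → Sig.stub_atomEqDrudeWeight →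
Sig.stub_conservedClassesEven → NoDrudeWeight`: transfer to `ℋ₀` (stub 1), read the atom as the Drude weight
of the current class (stub 2 with `⟪[J], U_t[J]⟫₀ = C_T(t)`), and kill the Drude weight by parity: every
conserved class is `Θ`-even (stub 3) while `Θ[J] = -[J]` and `Θ` is isometric, so `[J] ⊥ 𝒬₀`. -/
theorem NoDrudeWeight_of :
    Sig.stub_zeroWavenumberFramework → Sig.stub_atomEqDrudeWeight → Sig.stub_conservedClassesEven →
      Summit.AtomisticToContinuum.FouriersLaw.Theses.LatticeLandauDamping.NoDrudeWeight := by
  intro h1 h2 h3 ω₂ lam β γ hω hl hβ hγ T hT μT D hGibbs hshift hpres habs σ hfin hC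
  -- stub 1: the zero-wavenumber datum of (μ_T, D) with momentum reversal
  obtain ⟨Z, hZμ, hrev⟩ := h1 ω₂ lam β γ hω hl hβ hγ T hT μT D hGibbs hshift hpres habs
  subst hZμ
  -- `⟪[J], U_t [J]⟫₀ = C_T(t) = ∫ cos(ωt) dσ(ω)`
  have hrep : ∀ t : ℝ, ⟪Z.currentClass, Z.koopman t Z.currentClass⟫_ℝ =
      MeasureTheory.integral σ (fun ω : ℝ => Real.cos (ω * t)) :=
    fun t => (Z.inner_currentClass_koopman_eq_currentCorrelation' hrev t).trans (hC t)
  -- stub 2: the atom is the Drude weight of the current class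
  have hatom : (σ {0}).toReal = Z.toFluctuationDynamics.drudeWeight Z.currentClass :=
    h2 _ D Z Z.currentClass σ hfin hrep
  -- stub 3 + parity: `[J] ⊥ 𝒬₀`, so the Drude weight vanishes
  have hDW : Z.toFluctuationDynamics.drudeWeight Z.currentClass = 0 := by
    rw [FluctuationDynamics.drudeWeight_eq_zero_iff, Submodule.mem_orthogonal]
    intro u hu
    have heven : Z.reversal hrev u = u := h3 ω₂ lam β γ hω hl hβ hγ T hT D Z hGibbs hrev u hu
    have key : ⟪u, Z.currentClass⟫_ℝ = -⟪u, Z.currentClass⟫_ℝ := by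
      calc ⟪u, Z.currentClass⟫_ℝ
          = ⟪Z.reversal hrev u, Z.reversal hrev Z.currentClass⟫_ℝ :=
            (Z.inner_reversal_reversal hrev u Z.currentClass).symm
        _ = ⟪u, -Z.currentClass⟫_ℝ := by
            -- `u` lives in `Z.toFluctuationDynamics.FluctuationSpace`, definitionally `ℋ₀`; the two inner
            -- products agree up to unfolding `toFluctuationDynamics`, hence the closing `rfl`
            rw [heven, Z.reversal_currentClass hrev]
            try rfl
        _ = -⟪u, Z.currentClass⟫_ℝ := inner_neg_right _ _
    linarith
  rw [hDW] at hatom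
  -- a finite measure with `(σ {0}).toReal = 0` has `σ {0} = 0`
  have hne : σ {0} ≠ ∞ := by
    haveI := hfin
    exact MeasureTheory.measure_ne_top σ _
  rcases (ENNReal.toReal_eq_zero_iff _).1 hatom with h0 | htop
  · exact h0
  · exact absurd htop hne

/-- The skeleton instantiated through the sorried stubs (an `example`: registers nothing, leaves
`NoDrudeWeight_of` the unique crux-concluding declaration). -/
example : Summit.AtomisticToContinuum.FouriersLaw.Theses.LatticeLandauDamping.NoDrudeWeight :=
  NoDrudeWeight_of stub_zeroWavenumberFramework stub_atomEqDrudeWeight stub_conservedClassesEven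

end Summit.AtomisticToContinuum.FouriersLaw.Cruxes.NoDrudeWeight.Birth
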